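import Literature.RingTheory.Flat.IsomorphismModuloNilpotentRelative
import Mathlib.RingTheory.Unramified.Basic
import Mathlib.RingTheory.RingHom.Unramified
import Mathlib.RingTheory.Kaehler.TensorProduct
import Mathlib.LinearAlgebra.TensorProduct.Quotient
import Mathlib.RingTheory.Ideal.Quotient.Operations
import HarnessLib

/-!
# Formal unramifiedness is detected modulo a nilpotent ideal of the base

Topic `Literature/RingTheory/Etale`; theorems only (no definition, no named fact, no instance).
A ring map is formally unramified iff its module of Kähler differentials vanishes
([GortzWedhorn2023] Prop. 18.6), and Kähler differentials commute with base change (Mathlib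
`KaehlerDifferential.tensorKaehlerEquiv`). Hence, over a surjection `ρ : R → R₀` with NILPOTENT
kernel `J`, for `R → A → B` and the base changes `A₀ = A/JA`, `B₀ = B/JB`:
«`A₀ → B₀` formally unramified ⇒ `A → B` formally unramified» — `Ω_{B/A} ⊗_B B/JB = Ω_{B₀/A₀} = 0`
forces `Ω_{B/A} = J Ω_{B/A}`, hence `Ω_{B/A} = 0` by the nilpotent Nakayama lemma
([Schlessinger1968] Lemma 3.3, proof; tree form
`Literature.RingTheory.Flat.eq_bot_of_le_smul_of_isNilpotent`, no finiteness hypothesis).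
For morphisms locally of finite type this is the fibrewise criterion [GortzWedhorn2023] Prop. 18.29
(i) ⇔ (v) (a nilpotent thickening of the base does not change the fibres); the present form needs
neither finiteness nor flatness. Stated in the pushout currency of
`Literature/RingTheory/Flat/IsomorphismModuloNilpotentRelative.lean`, read off affine charts by
`Literature/AlgebraicGeometry/Morphisms/UnramifiedModuloNilpotent.lean`.

* `formallyUnramified_of_isPushout_of_isNilpotent_ker`.

## References
* [GortzWedhorn2023] U. Görtz, T. Wedhorn, *Algebraic Geometry II*, Prop. 18.6 (formally
  unramified ⇔ `Ω¹ = 0`), Remark 18.5 (2) (stable under base change), Prop. 18.29 (fibrewise).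
* [Schlessinger1968] M. Schlessinger, *Functors of Artin rings*, Trans. AMS 130 (1968), Lemma 3.3
  (proof), p. 216.
-/

universe u

open CategoryTheory CategoryTheory.Limits TensorProduct

namespace Literature.RingTheory.Etale

variable {R R₀ A A₀ B B₀ : CommRingCat.{u}}

/-- **Formal unramifiedness modulo a nilpotent thickening of the base.** Let `ρ : R ⟶ R₀` be a
surjective ring map with NILPOTENT kernel, `a : R ⟶ A`, and let
```
R  --a--> A --φ--> B
|ρ        |i       |j
v         v        v
R₀ -a₀--> A₀ -φ₀-> B₀
```
be two pushout squares (`A₀ = A/JA`, `B₀ = B/JB`, `J = ker ρ`). If `φ₀ : A₀ → B₀` is formally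
unramified, then so is `φ : A → B` (no flatness, no finiteness: `Ω_{B/A} ⊗_B B₀ ≅ Ω_{B₀/A₀} = 0`,
so `Ω_{B/A} = (JB)·Ω_{B/A}`, and `JB` is nilpotent). [cite: GortzWedhorn2023, Prop. 18.6 and
Prop. 18.29] [cite: Schlessinger1968, Lemma 3.3 (proof), p. 216] -/
theorem formallyUnramified_of_isPushout_of_isNilpotent_ker {ρ : R ⟶ R₀}
    (hρ : Function.Surjective ρ.hom) (hnil : IsNilpotent (RingHom.ker ρ.hom)) {a : R ⟶ A}
    {i : A ⟶ A₀} {a₀ : R₀ ⟶ A₀} (hA : IsPushout a ρ i a₀) {φ : A ⟶ B} {j : B ⟶ B₀}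
    {φ₀ : A₀ ⟶ B₀} (hB : IsPushout φ i j φ₀) (hφ₀ : φ₀.hom.FormallyUnramified) :
    φ.hom.FormallyUnramified := by
  classical
  -- algebra structures on the square `A → B → B₀`, `A → A₀ → B₀`
  letI : Algebra A B := φ.hom.toAlgebra
  letI : Algebra A A₀ := i.hom.toAlgebra
  letI : Algebra B B₀ := j.hom.toAlgebra
  letI : Algebra A₀ B₀ := φ₀.hom.toAlgebra
  letI : Algebra A B₀ := (i ≫ φ₀).hom.toAlgebra
  haveI : IsScalarTower A A₀ B₀ := IsScalarTower.of_algebraMap_eq fun _ => rfl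
  haveI : IsScalarTower A B B₀ := IsScalarTower.of_algebraMap_eq fun x =>
    (congrArg (fun ψ : A ⟶ B₀ => ψ.hom x) hB.w).symm
  haveI : Algebra.IsPushout A A₀ B B₀ := CommRingCat.isPushout_iff_isPushout.mp hB.flip
  -- `Ω[B₀⁄A₀] = 0`
  haveI : Algebra.FormallyUnramified A₀ B₀ := hφ₀
  -- hence `B₀ ⊗_B Ω[B⁄A] = 0`
  haveI h0 : Subsingleton (B₀ ⊗[B] Ω[B⁄A]) :=
    (KaehlerDifferential.tensorKaehlerEquiv A A₀ B B₀).toEquiv.subsingleton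
  -- `B₀ = B/I'` with `I' = ker j = JB` nilpotent
  have hAB : IsPushout (a ≫ φ) ρ j (a₀ ≫ φ₀) := hA.paste_horiz hB
  obtain ⟨hj, hkerj⟩ :=
    Literature.RingTheory.Flat.surjective_and_ker_eq_of_isPushout_of_surjective hρ hAB
  set I' : Ideal B := RingHom.ker j.hom with hI'def
  have hI'nil : IsNilpotent I' := by
    rw [hkerj]
    obtain ⟨n, hn⟩ := hnil
    exact ⟨n, by rw [← Ideal.map_pow, hn, Ideal.zero_eq_bot, Ideal.map_bot, Submodule.zero_eq_bot]⟩
  -- `B₀ ≃ₐ[B] B ⧸ I'`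
  have hj' : Function.Surjective (Algebra.ofId B B₀) := hj
  let e : (B ⧸ RingHom.ker (Algebra.ofId B B₀)) ≃ₐ[B] B₀ :=
    Ideal.quotientKerAlgEquivOfSurjective hj'
  have hkereq : RingHom.ker (Algebra.ofId B B₀) = I' := rfl
  -- `(B ⧸ I') ⊗_B Ω ≃ Ω ⧸ I'Ω` is a subsingleton, so `I' • ⊤ = ⊤`
  haveI h1 : Subsingleton ((B ⧸ I') ⊗[B] Ω[B⁄A]) := by
    rw [← hkereq]
    exact (TensorProduct.congr e.toLinearEquiv (LinearEquiv.refl B Ω[B⁄A])).toEquiv.subsingleton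
  have h2 : Subsingleton (Ω[B⁄A] ⧸ (I' • (⊤ : Submodule B Ω[B⁄A]))) :=
    (TensorProduct.quotTensorEquivQuotSMul Ω[B⁄A] I').symm.toEquiv.subsingleton
  have h3 : (I' • (⊤ : Submodule B Ω[B⁄A])) = ⊤ :=
    Submodule.Quotient.subsingleton_iff.mp h2
  -- nilpotent Nakayama: `Ω = I'Ω` with `I'` nilpotent forces `Ω = 0`
  have h4 : (⊤ : Submodule B Ω[B⁄A]) = ⊥ :=
    Literature.RingTheory.Flat.eq_bot_of_le_smul_of_isNilpotent hI'nil h3.ge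
  haveI : Subsingleton Ω[B⁄A] :=
    subsingleton_of_forall_eq 0 fun x => (Submodule.mem_bot B).mp (h4 ▸ Submodule.mem_top)
  exact Algebra.FormallyUnramified.mk inferInstance

end Literature.RingTheory.Etale
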